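import Mathlib.MeasureTheory.Integral.IntervalIntegral.FundThmCalculus
import Mathlib.Analysis.SpecialFunctions.Log.Deriv
import Mathlib.Analysis.Calculus.Deriv.MeanValue
import HarnessLib

/-!
# `QuantitativeBGN` (stmt-CriticalPhenomena-0913), line `microscopic-floor-doubling-gain` — STUB 3b `stub_russoCalc`

Crux `Summit.CriticalPhenomena.PercolationContinuityZ3.Theses.PercLowPointHalfSpace.QuantitativeBGN`
(item stmt-CriticalPhenomena-0913), line `microscopic-floor-doubling-gain`, stub `stub_russoCalc`
(the calculus half of the one-sided integrated Russo inequality; the percolation half is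
`stub_floorDeriv`, and the two are glued by the skeleton's `floorRusso_of`).

Statement proved: for continuous `f, g : ℝ → ℝ` with `f ≥ 0`, `g ≥ 0` and `HasDerivAt f (g t) t`
for every `t ∈ (0,1)`,
`f 0 * exp (∫ t in 0..1, g t / f t) ≤ f 1`.

Proof. If `f 0 = 0` the left-hand side vanishes and `f 1 ≥ 0`. Otherwise `0 < f 0`; since
`f' = g ≥ 0` on `(0,1)` and `f` is continuous on `[0,1]`, `f` is monotone on `[0,1]`
(`monotoneOn_of_deriv_nonneg`), so `f t ≥ f 0 > 0` on `[0,1]`. Then `log ∘ f` is continuous on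
`[0,1]` with derivative `g/f` on `(0,1)` (`HasDerivAt.log`), the integrand `g/f` is continuous on
`[0,1]` hence interval integrable, and the fundamental theorem of calculus
(`intervalIntegral.integral_eq_sub_of_hasDerivAt_of_le`) gives `∫₀¹ g/f = log (f 1) - log (f 0)`,
whence `f 0 * exp (∫₀¹ g/f) = f 0 * (f 1 / f 0) = f 1` (equality).
-/

noncomputable section

namespace Summit.CriticalPhenomena.PercolationContinuityZ3.Theorems

namespace FloorRussoCalc

/-- **Monotonicity from a nonnegative derivative.** If `f` is continuous with `HasDerivAt f (g t) t`
for `t ∈ (0,1)` and `g ≥ 0`, then `f 0 ≤ f t` for every `t ∈ [0,1]`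
(`monotoneOn_of_deriv_nonneg` on the convex set `[0,1]`, whose interior is `(0,1)`). [folklore] -/
theorem apply_zero_le {f g : ℝ → ℝ} (hf : Continuous f) (hg0 : ∀ t, 0 ≤ g t)
    (hderiv : ∀ t ∈ Set.Ioo (0 : ℝ) 1, HasDerivAt f (g t) t) {t : ℝ}
    (ht : t ∈ Set.Icc (0 : ℝ) 1) : f 0 ≤ f t := by
  have hmono : MonotoneOn f (Set.Icc (0 : ℝ) 1) := by
    refine monotoneOn_of_deriv_nonneg (convex_Icc 0 1) hf.continuousOn ?_ ?_
    · rw [interior_Icc]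
      exact fun x hx => (hderiv x hx).differentiableAt.differentiableWithinAt
    · rw [interior_Icc]
      intro x hx
      rw [(hderiv x hx).deriv]
      exact hg0 x
  exact hmono (Set.left_mem_Icc.2 zero_le_one) ht ht.1

/-- **FTC for `log ∘ f`.** Under the hypotheses of `apply_zero_le` and `0 < f 0` (so that `f > 0`
on `[0,1]`), with `g` continuous, `∫ t in 0..1, g t / f t = log (f 1) - log (f 0)`: the function
`log ∘ f` is continuous on `[0,1]` with derivative `g/f` on `(0,1)` (`HasDerivAt.log`), and the
continuous integrand `g/f` is interval integrable on `[0,1]`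
(`intervalIntegral.integral_eq_sub_of_hasDerivAt_of_le`). [folklore] -/
theorem integral_div_eq_log_sub {f g : ℝ → ℝ} (hf : Continuous f) (hg : Continuous g)
    (hg0 : ∀ t, 0 ≤ g t) (hderiv : ∀ t ∈ Set.Ioo (0 : ℝ) 1, HasDerivAt f (g t) t)
    (h0 : 0 < f 0) :
    ∫ t in (0 : ℝ)..1, g t / f t = Real.log (f 1) - Real.log (f 0) := by
  have hne : ∀ t ∈ Set.Icc (0 : ℝ) 1, f t ≠ 0 := fun t ht =>
    (h0.trans_le (apply_zero_le hf hg0 hderiv ht)).ne'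
  refine intervalIntegral.integral_eq_sub_of_hasDerivAt_of_le zero_le_one
    (hf.continuousOn.log hne) (fun x hx => ?_) ?_
  · exact (hderiv x hx).log (hne x (Set.Ioo_subset_Icc_self hx))
  · exact ContinuousOn.intervalIntegrable_of_Icc zero_le_one
      (hg.continuousOn.div hf.continuousOn hne)

end FloorRussoCalc

/-- **STUB 3b `stub_russoCalc`** (integrated one-sided Russo inequality, calculus half): for
continuous `f, g ≥ 0` with `HasDerivAt f (g t) t` on `(0,1)`, `f 0 · exp (∫₀¹ g/f) ≤ f 1`.
If `f 0 = 0` the left side is `0 ≤ f 1`; otherwise `f ≥ f 0 > 0` on `[0,1]`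
(`FloorRussoCalc.apply_zero_le`), `∫₀¹ g/f = log (f 1) - log (f 0)`
(`FloorRussoCalc.integral_div_eq_log_sub`), and `f 0 · exp (log (f 1) - log (f 0)) = f 1`
(`Real.exp_sub`, `Real.exp_log`), an equality. [folklore] -/
theorem stub_russoCalc :
    ∀ f g : ℝ → ℝ, Continuous f → Continuous g → (∀ t, 0 ≤ f t) → (∀ t, 0 ≤ g t) → (∀ t ∈ Set.Ioo (0 : ℝ) 1, HasDerivAt f (g t) t) → f 0 * Real.exp (∫ t in (0 : ℝ)..1, g t / f t) ≤ f 1 := by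
  intro f g hf hg hf0 hg0 hderiv
  rcases (hf0 0).eq_or_lt with h0 | h0
  · rw [← h0, zero_mul]
    exact hf0 1
  · have h1 : 0 < f 1 :=
      h0.trans_le (FloorRussoCalc.apply_zero_le hf hg0 hderiv (Set.right_mem_Icc.2 zero_le_one))
    rw [FloorRussoCalc.integral_div_eq_log_sub hf hg hg0 hderiv h0, Real.exp_sub, Real.exp_log h1,
      Real.exp_log h0, mul_div_cancel₀ _ h0.ne']
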